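import Summits.Ventures.PackingBounds.Energy.TenPointCkSixGramFast1
import Summits.Ventures.PackingBounds.Energy.TenPointCkSixGramFast2
import Summits.Ventures.PackingBounds.Energy.TenPointCkSixGramFast3
import Summits.Ventures.PackingBounds.Energy.TenPointCkSixGramFast4
import Summits.Ventures.PackingBounds.Energy.TenPointCkSixGramFast5
import Summits.Ventures.PackingBounds.Energy.TenPointCkSixGramFast6
import Summits.Ventures.PackingBounds.Energy.TenPointCkSixGramFast7
import Summits.Ventures.PackingBounds.Energy.TenPointCkSixGramFast8
import Summits.Ventures.PackingBounds.Energy.TenPointCkSixGramFast9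
import Summits.Ventures.PackingBounds.Energy.TenPointCkSixGramFast10
import HarnessLib

/-!
# The 153 × 153 SOS Gram block of `e3pt-sharp-n4N10ck6d8-rat.json` satisfies the integer PSD checks (collected)

Framing: lottery ticket; floor = certified bounds/negative ranges. Venture `PackingBounds`, cell
`pub-packcert`, energy family E3PT (pub-packcert-energy gen 15; n = 4, d = 8 kernel route = KERNEL-D6 double data route, size-split, list-route SOS bridge).

Diagonal dominance of `E` (`GramData.checkDD`, kernel evaluation), the row lengths of `L` (`GramData.checkLen`) and the collection `rowsW6_all` of the row-chunk
theorems of `TenPointCkSixGramFast1..10`; `GramData.psd_of_checks` then gives `Σ (S·Y)_ij y_i y_j ≥ 0` (applied in `TenPointCkSixSOS` through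
`GramData.listQuad_nonneg_of_congr`).
-/

namespace Summit.Ventures.PackingBounds.Energy.PentagonsSixD8

open Summit.Ventures.PackingBounds.Energy.GramData

set_option maxRecDepth 100000 in
set_option maxHeartbeats 0 in
/-- `E` is diagonally dominant: `Σ_j |E_ij| ≤ 2 E_ii` for all rows (kernel evaluation). -/
theorem ddW6_all : checkDD 153 eW6 = true := by decide +kernel

set_option maxRecDepth 100000 in
set_option maxHeartbeats 0 in
/-- Every row of `lW6` has length 153 (kernel evaluation). -/
theorem lenW6_L : checkLen 153 lW6 = true := by decide +kernel

/-- All rows: `(S·Y)_ij = Σ_c L_ic L_jc + E_ij` and `E_ij = E_ji` for `i, j < 153`. -/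
theorem rowsW6_all : ∀ i j, i < 153 → j < 153 →
    ent yW6 i j = dotRows lW6 i j 153 + ent eW6 i j ∧ ent eW6 i j = ent eW6 j i := by
  intro i j hi hj
  by_cases h0 : i < 16
  · exact of_checkRowsF rowsW6_0_16 lenW6_L i j (Nat.zero_le _) h0 hi hj
  by_cases h1 : i < 32
  · exact of_checkRowsF rowsW6_16_32 lenW6_L i j (by omega) h1 hi hj
  by_cases h2 : i < 48
  · exact of_checkRowsF rowsW6_32_48 lenW6_L i j (by omega) h2 hi hj
  by_cases h3 : i < 64
  · exact of_checkRowsF rowsW6_48_64 lenW6_L i j (by omega) h3 hi hj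
  by_cases h4 : i < 80
  · exact of_checkRowsF rowsW6_64_80 lenW6_L i j (by omega) h4 hi hj
  by_cases h5 : i < 96
  · exact of_checkRowsF rowsW6_80_96 lenW6_L i j (by omega) h5 hi hj
  by_cases h6 : i < 112
  · exact of_checkRowsF rowsW6_96_112 lenW6_L i j (by omega) h6 hi hj
  by_cases h7 : i < 128
  · exact of_checkRowsF rowsW6_112_128 lenW6_L i j (by omega) h7 hi hj
  by_cases h8 : i < 144
  · exact of_checkRowsF rowsW6_128_144 lenW6_L i j (by omega) h8 hi hj
  · exact of_checkRowsF rowsW6_144_153 lenW6_L i j (by omega) hi hi hj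

end Summit.Ventures.PackingBounds.Energy.PentagonsSixD8
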